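import Mathlib.LinearAlgebra.Dual.Lemmas
import Mathlib.LinearAlgebra.FiniteDimensional.Lemmas
import Mathlib.Data.Matrix.Mul
import Mathlib.LinearAlgebra.Matrix.ToLin
import Literature.Barriers.MatrixMultiplication.RectangularBarrierSliceDecomp
import HarnessLib

/-!
# The tri-budget lower bound for `S ⊙ ⟨a,b,c⟩`: `S·a·b·c ≤ r₁ b + r₂ c + r₃ a`

Topic `Literature/Barriers/MatrixMultiplication`; second file of the PROOF of the numerical table
`CLLZ2025_omegaTwo_barrier_CW` (Christandl–Le Gall–Lysikov–Zuiddam 2025, §4.4 Table 1) of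
`RectangularBarrier.lean` (see `RectangularBarrierSliceDecomp.lean` for the plan). In the printed
proof the role of this file is played by Lemma 4.1 there (Strassen 1991, §6: the support functionals
of `⟨a,b,c⟩` are `(ab)^{θ₁}(bc)^{θ₂}(ca)^{θ₃}`, whose lower-bound half rests on Strassen's lower support
functionals); here it is replaced by an elementary statement about tri-budget slice decompositions
(`HasSliceDecomp`), PROVED from scratch:

**Theorem** (`mmBlock_budget`, `HasSliceDecomp.multiple_matMul_budget`). Over any field, if the
`S`-fold direct sum `S ⊙ ⟨a,b,c⟩ = ⟨S⟩ ⊗ ⟨a,b,c⟩` is a sum of `r₁` tensors of `x`-rank one, `r₂`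
tensors of `y`-rank one and `r₃` tensors of `z`-rank one, then `S·a·b·c ≤ r₁·b + r₂·c + r₃·a`; i.e.
`r₁/|X| + r₂/|Y| + r₃/|Z| ≥ S` for the three flattening formats `|X| = ac`, `|Y| = ab`, `|Z| = bc` of
`⟨a,b,c⟩ = matMulTensor K a b c` — the flattenings are optimal even fractionally.

## Proof

Let `V₁ ≤ K^X`, `V₂ ≤ K^Y` be the annihilators of the coefficient functions of the `x`- and
`y`-slices (`codim V₁ ≤ r₁`, `codim V₂ ≤ r₂`). Contracting the decomposition against `v ∈ V₁`,
`w ∈ V₂` kills the first two groups, so every contraction `φ(v,w) = Σ_{x,y} v_x w_y D(x,y,·) ∈ K^Z`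
lies in the span of the `r₃` functions `f₃ʳ` (`dim ≤ r₃`). In block coordinates
(`x = ((σ,k),i)`, `y = ((σ,j),i)`, `z = (σ,(j,k))`) one has `φ(v,w)(σ,j,k) = Σ_i v_{(σ,k),i} w_{(σ,j),i}`.
Filter `V₁` by the blocks `(σ,k)` (numbered `k + cσ`) and `V₂` by the blocks `(σ,j)`: the leading
spaces `A_{σk}, B_{σj} ≤ Kᵃ` satisfy `Σ dim A_{σk} = dim V₁`, `Σ dim B_{σj} = dim V₂`
(`finrank_eq_sum_finrank_leadingSpace`, rank–nullity along the flag). Whenever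
`dim A_{σk} + dim B_{σj} > a` there are `v, w` with leading blocks `v̄ ∈ A_{σk}`, `w̄ ∈ B_{σj}`,
`v̄ ⬝ w̄ ≠ 0` (`exists_dotProduct_ne_zero`, the dot product being non-degenerate), and then
`φ(v,w)` has the entry `v̄ ⬝ w̄ ≠ 0` at `(σ,j,k)` and vanishes at every `(σ',j',k')` of larger number
`k' + cj' + bcσ'` (`blockRank_le`); such triangular families are linearly independent
(`linearIndependent_of_triangular`), so `#{good (σ,j,k)} ≤ r₃`. Finally
`a · #{bad} ≤ Σ_{σ,j,k} ((a − dim A_{σk}) + (a − dim B_{σj})) = b (Sca − dim V₁) + c (Sab − dim V₂) ≤ b r₁ + c r₂ + …`,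
which rearranges to the claim. Everything is PROVED; Mathlib supplies rank–nullity
(`LinearMap.finrank_range_add_finrank_ker`), `Subspace.finrank_add_finrank_dualCoannihilator_eq`
and `Matrix.rank_le_card_height`.

## References

* M. Christandl, F. Le Gall, V. Lysikov, J. Zuiddam, *Barriers for rectangular matrix
  multiplication*, comput. complexity 34 (2025) = arXiv:2003.03019, Lemma 4.1 and §4.4 (the role of
  this file in the proof of Table 1). [ChristandlLeGallLysikovZuiddam2025]
* V. Strassen, *Degeneration and complexity of bilinear maps: some asymptotic spectra*, J. reine
  angew. Math. 413 (1991), §6 (the support functionals of matrix multiplication; replaced here).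
-/

noncomputable section

open scoped BigOperators

namespace Literature.Barriers.MatrixMultiplication

open Literature.Computability.AlgebraicComplexity Finset Module

universe u

/-! ## Block filtrations of coordinate subspaces -/

section Filtration

variable {K : Type u} [Field K]
variable {B F : Type*} [Fintype B] [Fintype F] [DecidableEq B]

/-- Evaluation of a coordinate vector on the block `ℓ`: `v ↦ (i ↦ v (ℓ, i))`. [folklore] -/
def blockEval (ℓ : B) : (B × F → K) →ₗ[K] (F → K) :=
  LinearMap.funLeft K K (fun i : F => (ℓ, i))

omit [Fintype B] [Fintype F] [DecidableEq B] in
/-- Entries of `blockEval`. [folklore] -/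
@[simp] theorem blockEval_apply (ℓ : B) (v : B × F → K) (i : F) :
    blockEval (K := K) ℓ v i = v (ℓ, i) := rfl

/-- The flag of a block numbering `rk`: vectors supported on the blocks `ℓ` with `rk ℓ < t`.
[folklore] -/
def blockFlag (rk : B → ℕ) (t : ℕ) : Submodule K (B × F → K) where
  carrier := {v | ∀ ℓ i, t ≤ rk ℓ → v (ℓ, i) = 0}
  add_mem' := by
    intro v w hv hw ℓ i h
    simp [Pi.add_apply, hv ℓ i h, hw ℓ i h]
  zero_mem' := by
    intro ℓ i _
    rfl
  smul_mem' := by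
    intro c v hv ℓ i h
    simp [Pi.smul_apply, hv ℓ i h]

omit [Fintype B] [Fintype F] [DecidableEq B] in
/-- Membership in the flag. [folklore] -/
theorem mem_blockFlag {rk : B → ℕ} {t : ℕ} {v : B × F → K} :
    v ∈ blockFlag (K := K) rk t ↔ ∀ ℓ i, t ≤ rk ℓ → v (ℓ, i) = 0 := Iff.rfl

/-- The **leading space** of a subspace `W` at the block `ℓ`: the block-`ℓ` components of the
vectors of `W` supported on the blocks of rank `≤ rk ℓ` (the "pivot rows" of an echelon form of `W`
adapted to the block filtration). [folklore] -/
def leadingSpace (rk : B → ℕ) (W : Submodule K (B × F → K)) (ℓ : B) : Submodule K (F → K) :=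
  (W ⊓ blockFlag rk (rk ℓ + 1)).map (blockEval ℓ)

/-- **Telescoping**: `dim (W ∩ flag_t) = Σ_{rk ℓ < t} dim (leading space at ℓ)` (rank–nullity for
the evaluation on the top block, whose kernel is the previous step of the flag). [folklore] -/
theorem finrank_inf_blockFlag (rk : B → ℕ) (hrk : Function.Injective rk)
    (W : Submodule K (B × F → K)) (t : ℕ) :
    finrank K ↥(W ⊓ blockFlag rk t) =
      ∑ ℓ ∈ univ.filter (fun ℓ => rk ℓ < t), finrank K ↥(leadingSpace rk W ℓ) := by
  induction t with
  | zero =>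
    have h0 : blockFlag (K := K) (F := F) rk 0 = ⊥ := by
      ext v
      simp only [mem_blockFlag, zero_le, forall_const, Submodule.mem_bot]
      constructor
      · intro h
        funext p
        exact h p.1 p.2
      · rintro rfl ℓ i
        rfl
    rw [h0, inf_bot_eq, finrank_bot]
    simp
  | succ t ih =>
    by_cases hex : ∃ ℓ₀, rk ℓ₀ = t
    · obtain ⟨ℓ₀, hℓ₀⟩ := hex
      set p : Submodule K (B × F → K) := W ⊓ blockFlag rk (t + 1) with hp
      set f : ↥p →ₗ[K] (F → K) := (blockEval ℓ₀).comp p.subtype with hf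
      have hrange : LinearMap.range f = leadingSpace rk W ℓ₀ := by
        rw [hf, LinearMap.range_comp, Submodule.range_subtype, leadingSpace, hℓ₀]
      have hle : W ⊓ blockFlag rk t ≤ p := by
        refine inf_le_inf_left W fun v hv => ?_
        rw [mem_blockFlag] at hv ⊢
        exact fun ℓ i h => hv ℓ i (by omega)
      have hker : LinearMap.ker f = Submodule.comap p.subtype (W ⊓ blockFlag rk t) := by
        ext ⟨v, hv⟩
        have hvW : v ∈ W := (Submodule.mem_inf.1 hv).1
        have hvF : v ∈ blockFlag rk (t + 1) := (Submodule.mem_inf.1 hv).2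
        simp only [LinearMap.mem_ker, hf, LinearMap.coe_comp, Function.comp_apply,
          Submodule.coe_subtype, Submodule.mem_comap, Submodule.mem_inf, hvW, true_and]
        rw [mem_blockFlag] at hvF ⊢
        constructor
        · intro h ℓ i ht
          rcases (Nat.eq_or_lt_of_le ht) with heq | hlt
          · have hℓ : ℓ = ℓ₀ := hrk (by rw [hℓ₀, heq])
            subst hℓ
            exact congrFun h i
          · exact hvF ℓ i hlt
        · intro h
          funext i
          exact h ℓ₀ i (by rw [hℓ₀])
      have hkerdim : finrank K ↥(LinearMap.ker f) = finrank K ↥(W ⊓ blockFlag rk t) := by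
        rw [hker]
        exact LinearEquiv.finrank_eq (Submodule.comapSubtypeEquivOfLe hle)
      have hrn := LinearMap.finrank_range_add_finrank_ker f
      rw [hrange, hkerdim] at hrn
      have hfilter : univ.filter (fun ℓ => rk ℓ < t + 1) =
          insert ℓ₀ (univ.filter fun ℓ => rk ℓ < t) := by
        ext ℓ
        simp only [mem_filter, mem_univ, true_and, mem_insert]
        constructor
        · intro h
          rcases Nat.lt_succ_iff_lt_or_eq.1 h with h' | h'
          · exact Or.inr h'
          · exact Or.inl (hrk (by rw [hℓ₀, h']))
        · rintro (rfl | h)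
          · omega
          · omega
      have hnot : ℓ₀ ∉ univ.filter (fun ℓ => rk ℓ < t) := by simp [hℓ₀]
      rw [hfilter, Finset.sum_insert hnot, ← ih, ← hrn]
    · push Not at hex
      have hflag : blockFlag (K := K) (F := F) rk (t + 1) = blockFlag rk t := by
        ext v
        simp only [mem_blockFlag]
        constructor
        · intro h ℓ i ht
          exact h ℓ i (by have := hex ℓ; omega)
        · intro h ℓ i ht
          exact h ℓ i (by omega)
      have hfilter : univ.filter (fun ℓ => rk ℓ < t + 1) = univ.filter (fun ℓ => rk ℓ < t) := by
        ext ℓ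
        simp only [mem_filter, mem_univ, true_and]
        have := hex ℓ
        omega
      rw [hflag, hfilter, ih]

/-- **The block-filtration count**: `dim W = Σ_ℓ dim (leading space of W at ℓ)` for every
injective block numbering `rk`. [folklore] -/
theorem finrank_eq_sum_finrank_leadingSpace (rk : B → ℕ) (hrk : Function.Injective rk)
    (W : Submodule K (B × F → K)) :
    finrank K ↥W = ∑ ℓ, finrank K ↥(leadingSpace rk W ℓ) := by
  have h := finrank_inf_blockFlag rk hrk W (univ.sup rk + 1)
  have htop : blockFlag (K := K) (F := F) rk (univ.sup rk + 1) = ⊤ := by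
    ext v
    simp only [mem_blockFlag, Submodule.mem_top, iff_true]
    intro ℓ i h
    have := Finset.le_sup (f := rk) (mem_univ ℓ)
    omega
  have hfilter : univ.filter (fun ℓ => rk ℓ < univ.sup rk + 1) = univ := by
    ext ℓ
    simp only [mem_filter, mem_univ, true_and, iff_true]
    have := Finset.le_sup (f := rk) (mem_univ ℓ)
    omega
  rw [htop, inf_top_eq, hfilter] at h
  exact h

omit [Fintype B] [DecidableEq B] in
/-- Leading spaces are subspaces of `K^F`, of dimension `≤ |F|`. [folklore] -/
theorem finrank_leadingSpace_le (rk : B → ℕ) (W : Submodule K (B × F → K)) (ℓ : B) :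
    finrank K ↥(leadingSpace rk W ℓ) ≤ Fintype.card F :=
  (Submodule.finrank_le _).trans (finrank_fintype_fun_eq_card K).le

end Filtration

/-! ## Two linear-algebra lemmas: non-orthogonal pairs, triangular families -/

section LinAlg

variable {K : Type u} [Field K]

open Matrix in
/-- If `dim A + dim B > n` for subspaces `A, B ≤ Kⁿ`, some `v ∈ A`, `w ∈ B` have `v ⬝ᵥ w ≠ 0`
(the dot product is non-degenerate, so `B^⊥` has dimension `n - dim B`). [folklore] -/
theorem exists_dotProduct_ne_zero {n : Type*} [Fintype n] [DecidableEq n]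
    (A B : Submodule K (n → K)) (h : Fintype.card n < finrank K ↥A + finrank K ↥B) :
    ∃ v ∈ A, ∃ w ∈ B, v ⬝ᵥ w ≠ 0 := by
  by_contra hcon
  push Not at hcon
  -- the dot product as a map into the dual
  set D : (n → K) →ₗ[K] Module.Dual K (n → K) :=
    LinearMap.mk₂ K (fun w v => v ⬝ᵥ w) (fun w₁ w₂ v => dotProduct_add v w₁ w₂)
      (fun c w v => dotProduct_smul c v w) (fun w v₁ v₂ => add_dotProduct v₁ v₂ w)
      (fun c w v => smul_dotProduct c v w) with hD
  have hDapply : ∀ w v, D w v = v ⬝ᵥ w := fun w v => rfl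
  have hinj : Function.Injective D := by
    intro w₁ w₂ he
    funext i
    have := congrArg (fun φ : Module.Dual K (n → K) => φ (Pi.single i 1)) he
    simpa [hDapply, single_dotProduct] using this
  have hle : A ≤ (B.map D).dualCoannihilator := by
    intro v hv
    rw [Submodule.mem_dualCoannihilator]
    intro φ hφ
    obtain ⟨w, hw, rfl⟩ := Submodule.mem_map.1 hφ
    rw [hDapply]
    exact hcon v hv w hw
  have h1 := Subspace.finrank_add_finrank_dualCoannihilator_eq (B.map D)
  have h2 : finrank K ↥(B.map D) = finrank K ↥B :=
    (LinearEquiv.finrank_eq (Submodule.equivMapOfInjective D hinj B)).symm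
  have h3 := Submodule.finrank_mono hle
  rw [finrank_fintype_fun_eq_card] at h1
  omega

/-- **Triangular families are linearly independent**: if linear functionals `ev j` satisfy
`ev i (v i) ≠ 0` and `ev j (v i) = 0` whenever `N i < N j` for an injective numbering `N`, then
`v` is linearly independent (look at the largest index in a vanishing combination). [folklore] -/
theorem linearIndependent_of_triangular {ι M : Type*} [AddCommGroup M] [Module K M]
    (v : ι → M) (N : ι → ℕ) (hN : Function.Injective N) (ev : ι → (M →ₗ[K] K))
    (hdiag : ∀ i, ev i (v i) ≠ 0) (hoff : ∀ i j, N i < N j → ev j (v i) = 0) :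
    LinearIndependent K v := by
  classical
  rw [linearIndependent_iff']
  intro s g hsum
  by_contra hne
  push Not at hne
  obtain ⟨i₀, hi₀s, hgi₀⟩ := hne
  set s' := s.filter fun i => g i ≠ 0 with hs'
  have hs'ne : s'.Nonempty := ⟨i₀, by simp [hs', hi₀s, hgi₀]⟩
  obtain ⟨m, hm, hmax⟩ := s'.exists_max_image N hs'ne
  have hgm : g m ≠ 0 := (mem_filter.1 hm).2
  have hms : m ∈ s := (mem_filter.1 hm).1
  -- evaluate the vanishing combination at `ev m`
  have hev := congrArg (ev m) hsum
  rw [map_sum, map_zero] at hev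
  rw [Finset.sum_eq_single m] at hev
  · rw [map_smul, smul_eq_mul] at hev
    exact (mul_ne_zero hgm (hdiag m)) hev
  · intro i hi him
    by_cases hgi : g i = 0
    · simp [hgi]
    · have hle : N i ≤ N m := hmax i (by simp [hs', hi, hgi])
      have hlt : N i < N m := lt_of_le_of_ne hle (fun e => him (hN e))
      rw [map_smul, hoff i m hlt, smul_zero]
  · intro h
    exact absurd hms h

end LinAlg

/-! ## The tri-budget lower bound for `S ⊙ ⟨a,b,c⟩` -/

section MatMulLower

variable (K : Type u) [Field K]

/-- `S ⊙ ⟨a,b,c⟩` (the `S`-fold direct sum of the matrix multiplication tensor `⟨a,b,c⟩`, the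
tree's `kroneckerTensor (unitTensor K S) (matMulTensor K a b c)`) in *block coordinates*: the
`x`-variable `x_{σ,i,k}` is indexed by `((σ,k),i)`, the `y`-variable `y_{σ,i,j}` by `((σ,j),i)`, the
`z`-variable by `(σ,(j,k))`; entry `1` iff all the `σ`'s, the `i`'s, the `j`'s and the `k`'s agree.
[folklore] -/
def mmBlock (S a b c : ℕ) :
    (Fin S × Fin c) × Fin a → (Fin S × Fin b) × Fin a → Fin S × (Fin b × Fin c) → K :=
  fun x y z =>
    if (x.1.1 = y.1.1 ∧ y.1.1 = z.1) ∧ (x.2 = y.2 ∧ y.1.2 = z.2.1 ∧ x.1.2 = z.2.2) then 1 else 0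

variable {K}

/-- `mmBlock` is the relabelling of `S ⊙ ⟨a,b,c⟩`. [folklore] -/
theorem mmBlock_eq_comp (S a b c : ℕ) : mmBlock K S a b c = fun x y z =>
    kroneckerTensor (unitTensor K S) (matMulTensor K a b c)
      (x.1.1, (x.2, x.1.2)) (y.1.1, (y.2, y.1.2)) z := by
  funext x y z
  simp only [mmBlock, kroneckerTensor_apply, unitTensor_apply, matMulTensor, ite_zero_mul_ite_zero,
    one_mul]

/-- A tri-budget decomposition of `S ⊙ ⟨a,b,c⟩` is one of `mmBlock` (relabelling). [folklore] -/
theorem HasSliceDecomp.mmBlock_of_multiple {S a b c r₁ r₂ r₃ : ℕ}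
    (h : HasSliceDecomp (kroneckerTensor (unitTensor K S) (matMulTensor K a b c)) r₁ r₂ r₃) :
    HasSliceDecomp (mmBlock K S a b c) r₁ r₂ r₃ := by
  rw [mmBlock_eq_comp]
  exact h.comp _ _ _

/-- Rank arithmetic: with `j, j' < b` and `k, k' < c`, if `k' + cσ' ≤ k + cσ` and `j' + bσ' ≤ j + bσ`
then `(k' + c j') + bc σ' ≤ (k + c j) + bc σ`. [folklore] -/
theorem blockRank_le {b c σ σ' j j' k k' : ℕ} (hj' : j' < b) (hk : k < c) (hk' : k' < c)
    (H1 : k' + c * σ' ≤ k + c * σ) (H2 : j' + b * σ' ≤ j + b * σ) :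
    (k' + c * j') + b * c * σ' ≤ (k + c * j) + b * c * σ := by
  rcases Nat.lt_trichotomy σ' σ with h | h | h
  · have h1 : b * (σ' + 1) ≤ b * σ := Nat.mul_le_mul_left b h
    have h2 : j' + b * σ' + 1 ≤ j + b * σ := by nlinarith
    have h3 : c * (j' + b * σ' + 1) ≤ c * (j + b * σ) := Nat.mul_le_mul_left c h2
    nlinarith
  · subst h
    have : k' ≤ k := by omega
    have : j' ≤ j := by omega
    nlinarith
  · exfalso
    have h1 : c * (σ + 1) ≤ c * σ' := Nat.mul_le_mul_left c h
    nlinarith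

/-- **The tri-budget lower bound** (the one new linear-algebra lemma of the series): if the
`S`-fold direct sum of `⟨a,b,c⟩` is a sum of `r₁` tensors of `x`-rank one, `r₂` of `y`-rank one and
`r₃` of `z`-rank one, then `S·a·b·c ≤ r₁·b + r₂·c + r₃·a`, i.e. `r₁/|X| + r₂/|Y| + r₃/|Z| ≥ S` with
`|X| = ac`, `|Y| = ab`, `|Z| = bc` the three flattening formats — the flattenings are optimal even
fractionally. Proof: contract the decomposition against the annihilators `V₁`, `V₂` of the `x`- and
`y`-slice coefficient functions (codimension `≤ r₁`, `≤ r₂`); all contractions lie in the span of the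
`r₃` functions `f₃ʳ`; a block filtration of `V₁`, `V₂` (blocks = columns of the `x`- and `y`-matrices,
leading spaces `A_{σk}, B_{σj} ≤ Kᵃ` with `Σ dim A = dim V₁`, `Σ dim B = dim V₂`) produces, for every
`(σ,j,k)` with `dim A_{σk} + dim B_{σj} > a`, a contraction with a new leading coordinate, and
`a·#{(σ,j,k) : dim A_{σk} + dim B_{σj} ≤ a} ≤ b (Sca - dim V₁) + c (Sab - dim V₂)`. [folklore] -/
theorem mmBlock_budget {S a b c r₁ r₂ r₃ : ℕ} (h : HasSliceDecomp (mmBlock K S a b c) r₁ r₂ r₃) :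
    S * a * b * c ≤ r₁ * b + r₂ * c + r₃ * a := by
  classical
  obtain ⟨f₁, g₁, f₂, g₂, f₃, g₃, hdec⟩ := h
  -- Step 1: the annihilators of the `x`- and `y`-slice coefficient functions
  set M₁ : Matrix (Fin r₁) ((Fin S × Fin c) × Fin a) K := Matrix.of fun r x => f₁ r x with hM₁
  set M₂ : Matrix (Fin r₂) ((Fin S × Fin b) × Fin a) K := Matrix.of fun r y => f₂ r y with hM₂
  set V₁ : Submodule K ((Fin S × Fin c) × Fin a → K) := LinearMap.ker M₁.mulVecLin with hV₁
  set V₂ : Submodule K ((Fin S × Fin b) × Fin a → K) := LinearMap.ker M₂.mulVecLin with hV₂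
  have hV₁dim : S * c * a ≤ finrank K ↥V₁ + r₁ := by
    have h := LinearMap.finrank_range_add_finrank_ker M₁.mulVecLin
    have hr : finrank K ↥(LinearMap.range M₁.mulVecLin) ≤ r₁ := by
      simpa [Matrix.rank] using Matrix.rank_le_card_height M₁
    rw [finrank_fintype_fun_eq_card, ← hV₁] at h
    simp only [Fintype.card_prod, Fintype.card_fin] at h
    omega
  have hV₂dim : S * b * a ≤ finrank K ↥V₂ + r₂ := by
    have h := LinearMap.finrank_range_add_finrank_ker M₂.mulVecLin
    have hr : finrank K ↥(LinearMap.range M₂.mulVecLin) ≤ r₂ := by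
      simpa [Matrix.rank] using Matrix.rank_le_card_height M₂
    rw [finrank_fintype_fun_eq_card, ← hV₂] at h
    simp only [Fintype.card_prod, Fintype.card_fin] at h
    omega
  have hV₁ann : ∀ v ∈ V₁, ∀ r, ∑ x, f₁ r x * v x = 0 := by
    intro v hv r
    have h := congr_fun (LinearMap.mem_ker.1 hv) r
    simpa [hM₁, Matrix.mulVec, dotProduct] using h
  have hV₂ann : ∀ w ∈ V₂, ∀ r, ∑ y, f₂ r y * w y = 0 := by
    intro w hw r
    have h := congr_fun (LinearMap.mem_ker.1 hw) r
    simpa [hM₂, Matrix.mulVec, dotProduct] using h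
  -- Step 2: the contraction
  set φ : ((Fin S × Fin c) × Fin a → K) → ((Fin S × Fin b) × Fin a → K) →
      (Fin S × (Fin b × Fin c) → K) :=
    fun v w z => ∑ x, ∑ y, v x * w y * mmBlock K S a b c x y z with hφ
  have h2a : ∀ v ∈ V₁, ∀ w ∈ V₂, φ v w ∈ Submodule.span K (Set.range f₃) := by
    intro v hv w hw
    have key : φ v w = ∑ r, (∑ x, ∑ y, v x * w y * g₃ r x y) • f₃ r := by
      funext z
      simp only [hφ, Finset.sum_apply, Pi.smul_apply, smul_eq_mul]
      have e : ∀ x y, v x * w y * mmBlock K S a b c x y z =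
          (∑ r, v x * w y * (f₁ r x * g₁ r y z)) + (∑ r, v x * w y * (f₂ r y * g₂ r x z)) +
            (∑ r, v x * w y * (f₃ r z * g₃ r x y)) := by
        intro x y
        rw [hdec x y z, mul_add, mul_add, Finset.mul_sum, Finset.mul_sum, Finset.mul_sum]
      simp_rw [e, Finset.sum_add_distrib]
      have T1 : ∑ x, ∑ y, ∑ r, v x * w y * (f₁ r x * g₁ r y z) = 0 := by
        calc ∑ x, ∑ y, ∑ r, v x * w y * (f₁ r x * g₁ r y z)
            = ∑ x, ∑ r, ∑ y, v x * w y * (f₁ r x * g₁ r y z) :=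
              Finset.sum_congr rfl fun x _ => Finset.sum_comm
          _ = ∑ r, ∑ x, ∑ y, v x * w y * (f₁ r x * g₁ r y z) := Finset.sum_comm
          _ = ∑ r, (∑ x, f₁ r x * v x) * (∑ y, w y * g₁ r y z) := by
              refine Finset.sum_congr rfl fun r _ => ?_
              rw [Finset.sum_mul_sum]
              exact Finset.sum_congr rfl fun x _ => Finset.sum_congr rfl fun y _ => by ring
          _ = 0 := Finset.sum_eq_zero fun r _ => by rw [hV₁ann v hv r, zero_mul]
      have T2 : ∑ x, ∑ y, ∑ r, v x * w y * (f₂ r y * g₂ r x z) = 0 := by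
        calc ∑ x, ∑ y, ∑ r, v x * w y * (f₂ r y * g₂ r x z)
            = ∑ x, ∑ r, ∑ y, v x * w y * (f₂ r y * g₂ r x z) :=
              Finset.sum_congr rfl fun x _ => Finset.sum_comm
          _ = ∑ r, ∑ x, ∑ y, v x * w y * (f₂ r y * g₂ r x z) := Finset.sum_comm
          _ = ∑ r, (∑ y, f₂ r y * w y) * (∑ x, v x * g₂ r x z) := by
              refine Finset.sum_congr rfl fun r _ => ?_
              rw [Finset.sum_mul_sum, Finset.sum_comm]
              exact Finset.sum_congr rfl fun x _ => Finset.sum_congr rfl fun y _ => by ring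
          _ = 0 := Finset.sum_eq_zero fun r _ => by rw [hV₂ann w hw r, zero_mul]
      have T3 : ∑ x, ∑ y, ∑ r, v x * w y * (f₃ r z * g₃ r x y) =
          ∑ r, (∑ x, ∑ y, v x * w y * g₃ r x y) * f₃ r z := by
        calc ∑ x, ∑ y, ∑ r, v x * w y * (f₃ r z * g₃ r x y)
            = ∑ x, ∑ r, ∑ y, v x * w y * (f₃ r z * g₃ r x y) :=
              Finset.sum_congr rfl fun x _ => Finset.sum_comm
          _ = ∑ r, ∑ x, ∑ y, v x * w y * (f₃ r z * g₃ r x y) := Finset.sum_comm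
          _ = ∑ r, (∑ x, ∑ y, v x * w y * g₃ r x y) * f₃ r z := by
              refine Finset.sum_congr rfl fun r _ => ?_
              rw [Finset.sum_mul]
              refine Finset.sum_congr rfl fun x _ => ?_
              rw [Finset.sum_mul]
              exact Finset.sum_congr rfl fun y _ => by ring
      rw [T1, T2, T3, zero_add, zero_add]
    rw [key]
    exact Submodule.sum_mem _ fun r _ => Submodule.smul_mem _ _ (Submodule.subset_span ⟨r, rfl⟩)
  have h2b : ∀ v w (σ : Fin S) (j : Fin b) (k : Fin c),
      φ v w (σ, (j, k)) = ∑ i, v ((σ, k), i) * w ((σ, j), i) := by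
    intro v w σ j k
    simp only [hφ, mmBlock, mul_ite, mul_one, mul_zero]
    have inner : ∀ x : (Fin S × Fin c) × Fin a,
        (∑ y : (Fin S × Fin b) × Fin a,
          if (x.1.1 = y.1.1 ∧ y.1.1 = σ) ∧ (x.2 = y.2 ∧ y.1.2 = j ∧ x.1.2 = k)
            then v x * w y else 0) =
          if x.1.1 = σ ∧ x.1.2 = k then v x * w ((σ, j), x.2) else 0 := by
      intro x
      rw [Finset.sum_eq_single ((σ, j), x.2)]
      · by_cases hx : x.1.1 = σ ∧ x.1.2 = k
        · rw [if_pos hx, if_pos ⟨⟨hx.1, rfl⟩, rfl, rfl, hx.2⟩]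
        · rw [if_neg hx, if_neg]
          rintro ⟨⟨h1, h2⟩, -, -, h5⟩
          exact hx ⟨h1.trans h2, h5⟩
      · intro y _ hy
        rw [if_neg]
        rintro ⟨⟨-, h2⟩, h3, h4, -⟩
        exact hy (Prod.ext (Prod.ext h2 h4) h3.symm)
      · intro h
        exact absurd (Finset.mem_univ _) h
    simp_rw [inner]
    rw [Fintype.sum_prod_type, Finset.sum_eq_single (σ, k)]
    · simp
    · intro ℓ _ hℓ
      refine Finset.sum_eq_zero fun i _ => ?_
      rw [if_neg]
      rintro ⟨h1, h2⟩
      exact hℓ (Prod.ext h1 h2)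
    · intro h
      exact absurd (Finset.mem_univ _) h
  -- Step 3: block filtrations of `V₁`, `V₂`
  set rkx : Fin S × Fin c → ℕ := fun ℓ => (ℓ.2 : ℕ) + c * ℓ.1 with hrkxdef
  set rky : Fin S × Fin b → ℕ := fun ℓ => (ℓ.2 : ℕ) + b * ℓ.1 with hrkydef
  have hrkx : Function.Injective rkx := fun ℓ ℓ' he =>
    finProdFinEquiv.injective (Fin.ext he)
  have hrky : Function.Injective rky := fun ℓ ℓ' he =>
    finProdFinEquiv.injective (Fin.ext he)
  set Asp := leadingSpace rkx V₁ with hAsp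
  set Bsp := leadingSpace rky V₂ with hBsp
  have hsumA : finrank K ↥V₁ = ∑ ℓ, finrank K ↥(Asp ℓ) :=
    finrank_eq_sum_finrank_leadingSpace rkx hrkx V₁
  have hsumB : finrank K ↥V₂ = ∑ ℓ, finrank K ↥(Bsp ℓ) :=
    finrank_eq_sum_finrank_leadingSpace rky hrky V₂
  have hAle : ∀ ℓ, finrank K ↥(Asp ℓ) ≤ a := fun ℓ =>
    (finrank_leadingSpace_le rkx V₁ ℓ).trans (by simp)
  have hBle : ∀ ℓ, finrank K ↥(Bsp ℓ) ≤ a := fun ℓ =>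
    (finrank_leadingSpace_le rky V₂ ℓ).trans (by simp)
  -- Step 4: good triples
  set good : Fin S × (Fin b × Fin c) → Prop := fun z =>
    a < finrank K ↥(Asp (z.1, z.2.2)) + finrank K ↥(Bsp (z.1, z.2.1)) with hgood
  set G : Finset (Fin S × (Fin b × Fin c)) := univ.filter good with hG
  have hchoice : ∀ z : Fin S × (Fin b × Fin c), good z →
      ∃ v, v ∈ V₁ ⊓ blockFlag rkx (rkx (z.1, z.2.2) + 1) ∧
        ∃ w, w ∈ V₂ ⊓ blockFlag rky (rky (z.1, z.2.1) + 1) ∧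
          (blockEval (z.1, z.2.2) v) ⬝ᵥ (blockEval (z.1, z.2.1) w) ≠ 0 := by
    intro z hz
    obtain ⟨v', hv', w', hw', hne⟩ :=
      exists_dotProduct_ne_zero (Asp (z.1, z.2.2)) (Bsp (z.1, z.2.1)) (by simpa using hz)
    obtain ⟨v, hv, rfl⟩ := Submodule.mem_map.1 hv'
    obtain ⟨w, hw, rfl⟩ := Submodule.mem_map.1 hw'
    exact ⟨v, hv, w, hw, hne⟩
  choose! vsel hvsel wsel hwsel hne using hchoice
  have hdiag : ∀ z, good z → φ (vsel z) (wsel z) z ≠ 0 := by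
    rintro ⟨σ, j, k⟩ hz
    rw [h2b]
    simpa [dotProduct] using hne _ hz
  have hoff : ∀ z z', good z → (((z'.2.2 : ℕ) + c * z'.2.1) + b * c * z'.1 >
      ((z.2.2 : ℕ) + c * z.2.1) + b * c * z.1) → φ (vsel z) (wsel z) z' = 0 := by
    rintro ⟨σ, j, k⟩ ⟨σ', j', k'⟩ hz hlt
    rw [h2b]
    have hv := (Submodule.mem_inf.1 (hvsel _ hz)).2
    have hw := (Submodule.mem_inf.1 (hwsel _ hz)).2
    rw [mem_blockFlag] at hv hw
    have hcase : rkx (σ, k) + 1 ≤ rkx (σ', k') ∨ rky (σ, j) + 1 ≤ rky (σ', j') := by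
      by_contra hcon
      push Not at hcon
      have H1 : (k' : ℕ) + c * σ' ≤ k + c * σ := by
        have := hcon.1; simp only [hrkxdef] at this; omega
      have H2 : (j' : ℕ) + b * σ' ≤ j + b * σ := by
        have := hcon.2; simp only [hrkydef] at this; omega
      have := blockRank_le j'.2 k.2 k'.2 H1 H2
      simp only at hlt
      omega
    rcases hcase with h1 | h1
    · exact Finset.sum_eq_zero fun i _ => by rw [hv _ i h1, zero_mul]
    · exact Finset.sum_eq_zero fun i _ => by rw [hw _ i h1, mul_zero]
  -- Step 5: the contractions at good triples are linearly independent, so `#G ≤ r₃`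
  set NZ : Fin S × (Fin b × Fin c) → ℕ := fun z => ((z.2.2 : ℕ) + c * z.2.1) + b * c * z.1
    with hNZdef
  have hNZ : Function.Injective NZ := by
    intro z z' he
    have e1 : finProdFinEquiv (z.1, finProdFinEquiv (z.2.1, z.2.2)) =
        finProdFinEquiv (z'.1, finProdFinEquiv (z'.2.1, z'.2.2)) := by
      apply Fin.ext
      simp only [finProdFinEquiv_apply_val]
      simp only [hNZdef] at he
      linarith
    have e2 := finProdFinEquiv.injective e1
    simp only [Prod.mk.injEq] at e2
    have e3 := finProdFinEquiv.injective e2.2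
    simp only [Prod.mk.injEq] at e3
    exact Prod.ext e2.1 (Prod.ext e3.1 e3.2)
  set ψ : ↥G → (Fin S × (Fin b × Fin c) → K) := fun g => φ (vsel g.1) (wsel g.1) with hψ
  have hgoodG : ∀ g : ↥G, good g.1 := fun g => (mem_filter.1 g.2).2
  have hli : LinearIndependent K ψ :=
    linearIndependent_of_triangular ψ (fun g => NZ g.1) (fun g g' he => Subtype.ext (hNZ he))
      (fun g => LinearMap.proj (R := K) (φ := fun _ => K) g.1)
      (fun g => by simpa [hψ] using hdiag g.1 (hgoodG g))
      (fun g g' hlt => by simpa [hψ] using hoff g.1 g'.1 (hgoodG g) hlt)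
  have hGcard : G.card ≤ r₃ := by
    have hmem : ∀ g : ↥G, ψ g ∈ Submodule.span K (Set.range f₃) := fun g =>
      h2a _ (Submodule.mem_inf.1 (hvsel _ (hgoodG g))).1 _ (Submodule.mem_inf.1 (hwsel _ (hgoodG g))).1
    have hli' : LinearIndependent K
        (fun g : ↥G => (⟨ψ g, hmem g⟩ : ↥(Submodule.span K (Set.range f₃)))) :=
      LinearIndependent.of_comp (Submodule.span K (Set.range f₃)).subtype hli
    have h1 := hli'.fintype_card_le_finrank
    have h2 : finrank K ↥(Submodule.span K (Set.range f₃)) ≤ r₃ := by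
      have := finrank_range_le_card (R := K) f₃
      simpa [Set.finrank] using this
    have h3 : Fintype.card ↥G = G.card := Fintype.card_coe G
    omega
  -- Step 6: counting
  have hpt : ∀ z : Fin S × (Fin b × Fin c),
      a * (if good z then 0 else 1) + finrank K ↥(Asp (z.1, z.2.2)) +
        finrank K ↥(Bsp (z.1, z.2.1)) ≤ 2 * a := by
    intro z
    by_cases hz : good z
    · rw [if_pos hz]
      have := hAle (z.1, z.2.2)
      have := hBle (z.1, z.2.1)
      omega
    · rw [if_neg hz]
      have hz' : finrank K ↥(Asp (z.1, z.2.2)) + finrank K ↥(Bsp (z.1, z.2.1)) ≤ a := by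
        simpa [hgood] using hz
      omega
  have hsum := Finset.sum_le_sum fun z (_ : z ∈ (univ : Finset (Fin S × (Fin b × Fin c)))) => hpt z
  rw [Finset.sum_add_distrib, Finset.sum_add_distrib, ← Finset.mul_sum] at hsum
  have hbad : (∑ z : Fin S × (Fin b × Fin c), (if good z then 0 else 1 : ℕ)) =
      (univ.filter fun z => ¬ good z).card := by
    rw [Finset.card_filter]
    exact Finset.sum_congr rfl fun z _ => by by_cases hz : good z <;> simp [hz]
  have hA : (∑ z : Fin S × (Fin b × Fin c), finrank K ↥(Asp (z.1, z.2.2))) = b * finrank K ↥V₁ := by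
    calc (∑ z : Fin S × (Fin b × Fin c), finrank K ↥(Asp (z.1, z.2.2)))
        = ∑ σ : Fin S, ∑ _j : Fin b, ∑ k : Fin c, finrank K ↥(Asp (σ, k)) := by
          rw [Fintype.sum_prod_type]
          exact Finset.sum_congr rfl fun σ _ => Fintype.sum_prod_type _
      _ = ∑ σ : Fin S, b * ∑ k : Fin c, finrank K ↥(Asp (σ, k)) := by simp
      _ = b * finrank K ↥V₁ := by rw [hsumA, Fintype.sum_prod_type, Finset.mul_sum]
  have hB : (∑ z : Fin S × (Fin b × Fin c), finrank K ↥(Bsp (z.1, z.2.1))) = c * finrank K ↥V₂ := by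
    calc (∑ z : Fin S × (Fin b × Fin c), finrank K ↥(Bsp (z.1, z.2.1)))
        = ∑ σ : Fin S, ∑ j : Fin b, ∑ _k : Fin c, finrank K ↥(Bsp (σ, j)) := by
          rw [Fintype.sum_prod_type]
          exact Finset.sum_congr rfl fun σ _ => Fintype.sum_prod_type _
      _ = ∑ σ : Fin S, ∑ j : Fin b, c * finrank K ↥(Bsp (σ, j)) := by simp
      _ = c * finrank K ↥V₂ := by
          rw [hsumB, Fintype.sum_prod_type, Finset.mul_sum]
          simp_rw [Finset.mul_sum]
  have hZ : (∑ _z : Fin S × (Fin b × Fin c), 2 * a) = S * (b * c) * (2 * a) := by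
    simp only [Finset.sum_const, Finset.card_univ, Fintype.card_prod, Fintype.card_fin, smul_eq_mul]
  have hsplit : (univ.filter fun z => ¬ good z).card + G.card = S * (b * c) := by
    rw [hG, add_comm, Finset.card_filter_add_card_filter_not]
    simp [Fintype.card_prod]
  rw [hbad, hA, hB, hZ] at hsum
  -- final arithmetic
  set nbad := (univ.filter fun z => ¬ good z).card
  set nG := G.card
  set d₁ := finrank K ↥V₁
  set d₂ := finrank K ↥V₂
  have G2 : a * nbad + a * nG = a * (S * (b * c)) := by rw [← mul_add, hsplit]
  have G3 : a * nG ≤ a * r₃ := Nat.mul_le_mul_left a hGcard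
  have G4 : b * (S * c * a) ≤ b * (d₁ + r₁) := Nat.mul_le_mul_left b hV₁dim
  have G5 : c * (S * b * a) ≤ c * (d₂ + r₂) := Nat.mul_le_mul_left c hV₂dim
  nlinarith [hsum, G2, G3, G4, G5]


/-- **The tri-budget lower bound in the tree's encoding**: every `(r₁,r₂,r₃)`-slice decomposition of
`⟨S⟩ ⊗ ⟨a,b,c⟩ = kroneckerTensor (unitTensor K S) (matMulTensor K a b c)` (formats `|X| = ac`,
`|Y| = ab`, `|Z| = bc`) has `S·a·b·c ≤ r₁·b + r₂·c + r₃·a`. [folklore] -/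
theorem HasSliceDecomp.multiple_matMul_budget {S a b c r₁ r₂ r₃ : ℕ}
    (h : HasSliceDecomp (kroneckerTensor (unitTensor K S) (matMulTensor K a b c)) r₁ r₂ r₃) :
    S * a * b * c ≤ r₁ * b + r₂ * c + r₃ * a :=
  mmBlock_budget h.mmBlock_of_multiple

end MatMulLower

end Literature.Barriers.MatrixMultiplication

end
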